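import Mathlib
import Summits.QuantumAdvantage.QuantumAdvantage.Theorems.LivenessSeparationLawJ

set_option linter.dupNamespace false

/-!
# Liveness separation — part R (lens 4 «minimal counterexample», g28): ADJACENT cuts are never both dead — the forced live cover of a run

Cell `decomp-qadv`, seat lens-4, generation 28, RESIDUAL MODE beneath `Theses.AbsorptionDial.NoPerfectPolyOdd`
(stmt-QuantumAdvantage-28487); no ledger items. The game side of the ADJACENT-PAIR branch of the residual portrait (memo `S-PRIME.md` §10):

* `residue_succ_cut` — moving a cut by one position: `r(g+1) ≡ r(g) + 1 + u_g (mod 3)` (`r(g) = c + g + walkExp u g`);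
* `adjacent_live_or_live` — hence two ADJACENT cuts are never both dead: at every input one of them is live
  (while (live, dead), (dead, live), (live, live) all occur — the designability criterion for adjacent cuts is `R_{g+1} ≠ R_g`,
  brute-forced in the cell data `adjcrit.py`);
* `live_cover_of_run` — consequently a run of `2k` consecutive cuts `a, a+1, …, a+2k-1 ≤ n` carries AT LEAST `k` live cuts at EVERY input:
  on every sub-board and every class, a strategy whose quadratic registers occupy `ℓ + 1` consecutive cuts always has `⌊(ℓ+1)/2⌋` of them live —
  the reason the sequential scheme S′/S″ (parts J–Q) stops at «two disjoint adjacent pairs» and the dense rung is the summit regime.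
-/

namespace Summit.QuantumAdvantage.QuantumAdvantage.Theorems.LivenessSeparation

open Finset Summit.QuantumAdvantage.AdviceFreeQNC0 Summit.QuantumAdvantage.QuantumAdvantage.Theorems.InnerDegreeDial

variable {n : ℕ}

/-- ONE STEP OF THE CUT: the walk residue at the cut `g + 1` is the residue at `g` plus `1` plus the bit `u_g` (mod 3). -/
theorem residue_succ_cut (c : ℕ) (u : Fin n → Bool) (g : Fin n) :
    (c + (g.val + 1) + walkExp u (g.val + 1)) % 3 =
      (c + g.val + walkExp u g.val + 1 + (if u g = true then 1 else 0)) % 3 := by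
  have h := walkExp_eq_add_card u (show g.val ≤ g.val + 1 by omega)
  by_cases hu : u g = true
  · have hw : (univ.filter fun i : Fin n => g.val ≤ i.val ∧ i.val < g.val + 1 ∧ u i = true) = {g} := by
      ext i
      simp only [mem_filter, mem_univ, true_and, mem_singleton]
      constructor
      · rintro ⟨h1, h2, -⟩
        exact Fin.ext (by omega)
      · rintro rfl
        exact ⟨le_rfl, by omega, hu⟩
    rw [hw, card_singleton] at h
    rw [if_pos hu, h]
    omega
  · have hw : (univ.filter fun i : Fin n => g.val ≤ i.val ∧ i.val < g.val + 1 ∧ u i = true).card = 0 := by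
      rw [Finset.card_eq_zero, Finset.filter_eq_empty_iff]
      rintro i - ⟨h1, h2, h3⟩
      have hi : i = g := Fin.ext (by omega)
      rw [hi] at h3
      exact hu h3
    rw [hw] at h
    rw [if_neg hu, h]
    omega

/-- ADJACENT CUTS ARE NEVER BOTH DEAD: for every input, one of the cuts `g`, `g + 1` (`g < n`) is live. -/
theorem adjacent_live_or_live (c : ℕ) (u : Fin n → Bool) (g : Fin n) :
    liveCut c u g.castSucc = true ∨ liveCut c u g.succ = true := by
  have h := residue_succ_cut c u g
  by_cases h0 : (c + g.val + walkExp u g.val) % 3 = 0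
  · right
    unfold liveCut
    rw [Fin.val_succ]
    apply decide_eq_true
    by_cases hu : u g = true
    · rw [if_pos hu] at h
      omega
    · rw [if_neg hu] at h
      omega
  · left
    unfold liveCut
    rw [Fin.val_castSucc]
    exact decide_eq_true h0

/-- THE FORCED LIVE COVER OF A RUN: among `2k` consecutive cuts `a, a + 1, …, a + 2k - 1` (all `≤ n`) at least `k` are live at EVERY input —
pair them up and apply `adjacent_live_or_live`.  So `ℓ + 1` consecutive quadratic cuts keep `⌊(ℓ+1)/2⌋` quadratic registers live on every
class of every sub-board: no liveness design can thin a run below half. -/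
theorem live_cover_of_run (c : ℕ) (u : Fin n → Bool) (a : ℕ) :
    ∀ k : ℕ, a + 2 * k ≤ n + 1 →
      k ≤ (univ.filter fun g : Fin (n + 1) => a ≤ g.val ∧ g.val < a + 2 * k ∧ liveCut c u g = true).card := by
  intro k
  induction k with
  | zero => intro _; exact Nat.zero_le _
  | succ k ih =>
    intro hk
    have hk' : a + 2 * k ≤ n + 1 := by omega
    have hlt : a + 2 * k < n := by omega
    set g₀ : Fin n := ⟨a + 2 * k, hlt⟩ with hg₀
    -- the live one of the pair (a + 2k, a + 2k + 1)
    obtain ⟨x, hxval, hxlive⟩ : ∃ x : Fin (n + 1), (x.val = a + 2 * k ∨ x.val = a + 2 * k + 1) ∧ liveCut c u x = true := by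
      rcases adjacent_live_or_live c u g₀ with h | h
      · exact ⟨g₀.castSucc, Or.inl (by rw [Fin.val_castSucc]), h⟩
      · exact ⟨g₀.succ, Or.inr (by rw [Fin.val_succ]), h⟩
    have hsub : insert x (univ.filter fun g : Fin (n + 1) => a ≤ g.val ∧ g.val < a + 2 * k ∧ liveCut c u g = true)
        ⊆ (univ.filter fun g : Fin (n + 1) => a ≤ g.val ∧ g.val < a + 2 * (k + 1) ∧ liveCut c u g = true) := by
      intro g hg
      rw [mem_insert] at hg
      simp only [mem_filter, mem_univ, true_and] at hg ⊢
      rcases hg with rfl | ⟨h1, h2, h3⟩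
      · rcases hxval with hv | hv <;> exact ⟨by omega, by omega, hxlive⟩
      · exact ⟨h1, by omega, h3⟩
    have hnot : x ∉ (univ.filter fun g : Fin (n + 1) => a ≤ g.val ∧ g.val < a + 2 * k ∧ liveCut c u g = true) := by
      simp only [mem_filter, mem_univ, true_and, not_and]
      intro _ h2
      rcases hxval with hv | hv <;> omega
    have := card_le_card hsub
    rw [card_insert_of_notMem hnot] at this
    have := ih hk'
    omega

end Summit.QuantumAdvantage.QuantumAdvantage.Theorems.LivenessSeparation
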